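import Summits.PneNP.PneNP.Theorems.ChebyshevTracialDesignPsdFactorDegree
import Summits.PneNP.PneNP.Theorems.ChebyshevTracialDesignWellConditionedDensity
import Summits.PneNP.PneNP.Theorems.ChebyshevTracialDesignAPrioriBounds
import Summits.PneNP.PneNP.Theorems.ChebyshevTracialDesignFreeBinning
import HarnessLib

/-!
# Cell pnp-psdrank, route `ChebyshevTracialDesign`: the CURRENCY of psd block decompositions — design values are additive over psd
# blocks on either side, and a cut side split into a LOW-DEGREE GRAM block (sign), a block WELL-CONDITIONED against the matching side
# (domination) and a TRACE-SMALL block (junk) is priced at `tail·r + (Σ|w_c|)·mass` (crux `TracialDecayExp20`, stmt-PneNP-19878)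

Brick 88 (prover g17; MEMO-19 §2(h)/§4(2) asked for "value is linear in X and in Y packaged as `value_add_left/right` + 'a psd sum of a
low-degree Gram field and a well-conditioned field has value ≤ tail·r' (23 + 87d), to fix the currency of the decomposition"; MEMO-20 §1).
The three r-UNIFORM mechanisms the tree has for the crux are, by name:
* SIGN — `…JuntaLowDegree.sum_levelWeight_trace_nonpos_of_lowDegree` (cut-side Gram factor `A_U A_Uᵀ` of Johnson degree `≤ k`, `2k ≤ D`,
  `4k ≤ t`, matching side ANY psd family; unconditional since `Grigoriev2001_knapsackFormNonneg_holds`) and its matching-side twin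
  `…PseudoMatchingBaseTransport.sum_levelWeight_trace_nonpos_of_lowDegreeM` (`6k+1 ≤ t`, `6k+1 ≤ n−t`): design value `≤ 0`;
* DOMINATION — `…WellConditionedDensity.value_le_tail_of_minDensity` (brick 87d): a pair of psd-contraction families with
  `Σ_{|U|=t} X_U ⪰ μ·C(n,t)·I`, `Σ_M Y_M ⪰ ν·|PM|·I`, `μν ≥ 64/n` has design value `≤ r·(Σ_c|w_c|)·√P_{D/2+1}` at EVERY dimension `r`;
* JUNK — (§2 here, `value_le_absVar_mul_traceMass`) a psd cut family of small slice trace mass `Σ_{|U|=t} tr X_U ≤ m·#{t-cuts}` has design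
  value `≤ (Σ_c|w_c|)·m` against every contraction-valued matching side (row sums of `|levelWeight|` are `(Σ_c|w_c|)/#{t-cuts}`, §2
  `rowSum_absWeight_le`).
Since the design value `Σ_{U,M} W(U,M)·tr(X_U Y_M)` is ADDITIVE over psd sums on either side (§1 `value_add_left/right`, `value_sum_left/right` —
a psd sum `X = Σ_i X^{(i)}` is the same thing as a column-block structure `B = [B^{(1)} | B^{(2)} | …]` of a Gram factor `X = B Bᵀ`), ANY splitting
of the cut side into blocks of the three kinds is priced blockwise (§3):
* `value_le_tail_of_lowDegree_add_wellConditioned` — `X = A Aᵀ + X₂` (low-degree Gram + well-conditioned against `Y`): value `≤ tail·r`;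
* `value_le_tail_of_wellConditioned_add_lowDegreeM` — the matching-side mirror `Y = B Bᵀ + Y₂`;
* `value_le_tail_of_fourBlocks` — both sides split, `X = A Aᵀ + X₂`, `Y = B Bᵀ + Y₂`: the four cross values are SIGN, SIGN, SIGN, DOMINATION;
* `value_le_of_threeBlocks` — `X = A Aᵀ + X₂ + X₃` with `X₃` trace-small: value `≤ tail·r + (Σ_c|w_c|)·m`.
So the crux's open content is an EXISTENCE statement: does every contraction field `X` (for the `Y` that matter, brick 86) split — with the
blocks allowed to depend on `Y` — into a Gram block of degree `≤ D/2`, a block well-conditioned against `Y`, and trace-mass `≤ e^{−aD}·r/40`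
(MEMO-19 §2(h); MEMO-20 §1 records why the blocks of a psd sum carry no cross terms while a harmonic split of ONE Gram factor does).
[cite: Grigoriev2001, Lemma 1.4 (PDF p. 8)] [cite: Rothvoss2017, §2 (PDF p. 6)] [cite: GriblingDelaatLaurent2019, §5]
[cite: BrietDadushPokutta2014, Thm. 6 (§3)]
Stature: support/instrument (compositions of landed bricks; kernel lane, no defs, axioms standard). WHAT THIS IS NOT: no decomposition theorem,
no proof or refutation of the crux, nothing on psd rank of P_PM(K_n), no P-vs-NP content. Supports stmt-PneNP-19878.
-/

set_option linter.dupNamespace false -- `Summit.PneNP.PneNP.…`: summit = sub-problem (D-0017)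

noncomputable section

namespace Summit.PneNP.PneNP.Theorems.ChebyshevTracialDesignBlockDecomposition

open Finset Matrix Literature.Barriers.PneNP Literature.Combinatorics.Optimization
open Literature.Computability.Complexity (Grigoriev2001_knapsackFormNonneg_holds)
open Summit.PneNP.PneNP.Theorems.ChebyshevTracialDesignJunta (sum_levelWeight_trace_nonpos_of_lowDegree)
open Summit.PneNP.PneNP.Theorems.ChebyshevTracialDesignPseudoMatchingBaseTransport (sum_levelWeight_trace_nonpos_of_lowDegreeM)
open Summit.PneNP.PneNP.Theorems.ChebyshevTracialDesignWellConditionedDensity (value_le_tail_of_minDensity)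
open Summit.PneNP.PneNP.Theorems.ChebyshevTracialDesignAPrioriBounds (trace_mul_le_trace_left trace_le_of_sub_posSemidef)
open Summit.PneNP.PneNP.Theorems.ChebyshevTracialDesignLevelMarginals (card_Qset_eq_rowCount_mul card_Qset_eq_colCount_mul)
open Summit.PneNP.PneNP.Theorems.ChebyshevTracialDesignBoundedDim (absWeight absWeight_nonneg levelWeight_le_absWeight)
open Summit.PneNP.PneNP.Theorems.ChebyshevTracialDesignFreeBinning (trace_mul_nonneg_of_psd abs_trace_mul_le abs_levelWeight_le_absWeight)

variable {n r : ℕ}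

/-! ### §1 Additivity of the design value over psd blocks (Gram column blocks) on either side -/

/-- The design value is additive in the cut side: `value(X₁ + X₂, Y) = value(X₁, Y) + value(X₂, Y)`. [folklore] -/
theorem value_add_left (W : OddSet n → PMatch n → ℝ) (X₁ X₂ : OddSet n → Matrix (Fin r) (Fin r) ℝ)
    (Y : PMatch n → Matrix (Fin r) (Fin r) ℝ) :
    ∑ U, ∑ M, W U M * ((X₁ U + X₂ U) * Y M).trace =
      ∑ U, ∑ M, W U M * (X₁ U * Y M).trace + ∑ U, ∑ M, W U M * (X₂ U * Y M).trace := by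
  simp only [Matrix.add_mul, trace_add, mul_add, sum_add_distrib]

/-- The design value is additive in the matching side: `value(X, Y₁ + Y₂) = value(X, Y₁) + value(X, Y₂)`. [folklore] -/
theorem value_add_right (W : OddSet n → PMatch n → ℝ) (X : OddSet n → Matrix (Fin r) (Fin r) ℝ)
    (Y₁ Y₂ : PMatch n → Matrix (Fin r) (Fin r) ℝ) :
    ∑ U, ∑ M, W U M * (X U * (Y₁ M + Y₂ M)).trace =
      ∑ U, ∑ M, W U M * (X U * Y₁ M).trace + ∑ U, ∑ M, W U M * (X U * Y₂ M).trace := by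
  simp only [mul_add, trace_add, sum_add_distrib]

/-- The design value is additive over any finite psd-block decomposition of the cut side, `X_U = Σ_{i∈s} X^{(i)}_U` — equivalently over the
column blocks of a Gram factor `X_U = B_U B_Uᵀ = Σ_i B^{(i)}_U (B^{(i)}_U)ᵀ`. [folklore] -/
theorem value_sum_left {ι : Type*} (s : Finset ι) (W : OddSet n → PMatch n → ℝ)
    (X : ι → OddSet n → Matrix (Fin r) (Fin r) ℝ) (Y : PMatch n → Matrix (Fin r) (Fin r) ℝ) :
    ∑ U, ∑ M, W U M * ((∑ i ∈ s, X i U) * Y M).trace = ∑ i ∈ s, ∑ U, ∑ M, W U M * (X i U * Y M).trace := by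
  calc ∑ U, ∑ M, W U M * ((∑ i ∈ s, X i U) * Y M).trace
      = ∑ U, ∑ M, ∑ i ∈ s, W U M * (X i U * Y M).trace := by
        refine sum_congr rfl fun U _ => sum_congr rfl fun M _ => ?_
        rw [sum_mul, trace_sum, mul_sum]
    _ = ∑ U, ∑ i ∈ s, ∑ M, W U M * (X i U * Y M).trace := sum_congr rfl fun U _ => sum_comm
    _ = ∑ i ∈ s, ∑ U, ∑ M, W U M * (X i U * Y M).trace := sum_comm

/-- The design value is additive over any finite psd-block decomposition of the matching side, `Y_M = Σ_{i∈s} Y^{(i)}_M`. [folklore] -/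
theorem value_sum_right {ι : Type*} (s : Finset ι) (W : OddSet n → PMatch n → ℝ)
    (X : OddSet n → Matrix (Fin r) (Fin r) ℝ) (Y : ι → PMatch n → Matrix (Fin r) (Fin r) ℝ) :
    ∑ U, ∑ M, W U M * (X U * ∑ i ∈ s, Y i M).trace = ∑ i ∈ s, ∑ U, ∑ M, W U M * (X U * Y i M).trace := by
  calc ∑ U, ∑ M, W U M * (X U * ∑ i ∈ s, Y i M).trace
      = ∑ U, ∑ M, ∑ i ∈ s, W U M * (X U * Y i M).trace := by
        refine sum_congr rfl fun U _ => sum_congr rfl fun M _ => ?_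
        rw [mul_sum, trace_sum, Finset.mul_sum]
    _ = ∑ U, ∑ i ∈ s, ∑ M, W U M * (X U * Y i M).trace := sum_congr rfl fun U _ => sum_comm
    _ = ∑ i ∈ s, ∑ U, ∑ M, W U M * (X U * Y i M).trace := sum_comm

/-- A Gram block is psd: `A Aᵀ ⪰ 0`. [folklore] -/
theorem posSemidef_mul_transpose_self {m : ℕ} (A : Matrix (Fin r) (Fin m) ℝ) : (A * Aᵀ).PosSemidef := by
  simpa [conjTranspose_eq_transpose_of_trivial] using posSemidef_self_mul_conjTranspose A

/-! ### §2 JUNK: a trace-small psd block is priced by its slice trace mass -/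

/-- **Row sums of `|levelWeight|`.** For every cut `U`: `Σ_M absWeight(U,M) ≤ (Σ_{c∈C} |w_c|) / #{t-cuts}` (with equality on the `t`-cuts whose
level classes are all nonempty, `0` off the `t`-cuts): each level class `Q_c(t)` has `#{M : cc(U,M) = c}·#{t-cuts}` elements for every `t`-cut `U`
(`…LevelMarginals.card_Qset_eq_rowCount_mul`). [cite: Rothvoss2017, §2 (PDF p. 6)] -/
theorem rowSum_absWeight_le (t : ℕ) (C : Finset ℕ) (w : ℕ → ℝ) (U : OddSet n) :
    ∑ M, absWeight n t C w U M ≤ (∑ c ∈ C, |w c|) / ((univ.filter fun U' : OddSet n => U'.1.card = t).card : ℝ) := by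
  classical
  unfold absWeight
  rw [sum_comm, sum_div]
  refine sum_le_sum fun c _ => ?_
  by_cases hU : U.1.card = t
  · -- on the `t`-cuts: `#{M : (U,M) ∈ Q_c} · (|w_c| / |Q_c|) = |w_c| / #{t-cuts}` (or `0`)
    have hmem : ∀ M : PMatch n, ((U, M) ∈ Qset n t c ↔ cc U M = c) := fun M => by
      rw [mem_Qset_iff]; exact ⟨fun h => h.2, fun h => ⟨hU, h⟩⟩
    have h1 : ∑ M : PMatch n, (if (U, M) ∈ Qset n t c then |w c| / ((Qset n t c).card : ℝ) else 0) =
        ((univ.filter fun M : PMatch n => cc U M = c).card : ℝ) * (|w c| / ((Qset n t c).card : ℝ)) := by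
      have hfilt : (univ.filter fun M : PMatch n => (U, M) ∈ Qset n t c) = univ.filter fun M : PMatch n => cc U M = c :=
        filter_congr fun M _ => hmem M
      rw [← sum_filter, sum_const, nsmul_eq_mul, hfilt]
    rw [h1, card_Qset_eq_rowCount_mul t c U hU]
    set R : ℝ := ((univ.filter fun M : PMatch n => cc U M = c).card : ℝ) with hR
    set N : ℝ := ((univ.filter fun U' : OddSet n => U'.1.card = t).card : ℝ) with hN
    have hN0 : 0 < N := by
      rw [hN]; exact_mod_cast card_pos.2 ⟨U, by simp [hU]⟩
    rcases eq_or_lt_of_le (show (0 : ℝ) ≤ R by positivity) with hR0 | hRpos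
    · rw [← hR0]; simp only [zero_mul]; positivity
    · rw [mul_div_assoc', div_le_div_iff₀ (by positivity) hN0]
      nlinarith [abs_nonneg (w c)]
  · -- off the `t`-cuts every summand vanishes
    have h0 : ∑ M : PMatch n, (if (U, M) ∈ Qset n t c then |w c| / ((Qset n t c).card : ℝ) else 0) = 0 := by
      refine sum_eq_zero fun M _ => ?_
      rw [if_neg]
      rw [mem_Qset_iff]; exact fun h => hU h.1
    rw [h0]; positivity

/-- `0 ≤ tr(X Y) ≤ tr X` for `X ⪰ 0` and a psd contraction `Y`. [folklore] -/
theorem trace_mul_mem_Icc {X Y : Matrix (Fin r) (Fin r) ℝ} (hX : X.PosSemidef) (hY : Y.PosSemidef ∧ (1 - Y).PosSemidef) :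
    0 ≤ (X * Y).trace ∧ (X * Y).trace ≤ X.trace :=
  ⟨trace_mul_nonneg_of_psd hX hY.1, trace_mul_le_trace_left hX hY.2⟩

/-- **JUNK BLOCK.** For a multilevel weight `W = levelWeight n t C w`, ANY psd cut family `X₃` (no contraction bound needed) and any
contraction-valued matching side `Y`: `Σ_{U,M} W(U,M)·tr(X₃_U Y_M) ≤ (Σ_c |w_c|) · (Σ_U tr X₃_U) / #{t-cuts}` — a block of slice trace mass
`Σ_{|U|=t} tr X₃_U ≤ m·#{t-cuts}` costs at most `(Σ_c|w_c|)·m` (only the `t`-cuts enter `W`; the sum over all cuts is an upper bound).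
[cite: Rothvoss2017, §2 (PDF p. 6)] [cite: BrietDadushPokutta2014, Thm. 6 (§3)] -/
theorem value_le_absVar_mul_traceMass (t : ℕ) (C : Finset ℕ) (w : ℕ → ℝ)
    (X₃ : OddSet n → Matrix (Fin r) (Fin r) ℝ) (hX₃ : ∀ U, (X₃ U).PosSemidef)
    (Y : PMatch n → Matrix (Fin r) (Fin r) ℝ) (hY : ∀ M, (Y M).PosSemidef ∧ (1 - Y M).PosSemidef) :
    ∑ U, ∑ M, levelWeight n t C w U M * (X₃ U * Y M).trace ≤
      (∑ c ∈ C, |w c|) / ((univ.filter fun U' : OddSet n => U'.1.card = t).card : ℝ) * ∑ U, (X₃ U).trace := by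
  rw [mul_sum]
  refine sum_le_sum fun U _ => ?_
  calc ∑ M, levelWeight n t C w U M * (X₃ U * Y M).trace
      ≤ ∑ M, absWeight n t C w U M * (X₃ U).trace := by
        refine sum_le_sum fun M _ => ?_
        obtain ⟨h0, h1⟩ := trace_mul_mem_Icc (hX₃ U) (hY M)
        calc levelWeight n t C w U M * (X₃ U * Y M).trace ≤ absWeight n t C w U M * (X₃ U * Y M).trace :=
              mul_le_mul_of_nonneg_right (levelWeight_le_absWeight t C w U M) h0
          _ ≤ absWeight n t C w U M * (X₃ U).trace := mul_le_mul_of_nonneg_left h1 (absWeight_nonneg t C w U M)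
    _ = (∑ M, absWeight n t C w U M) * (X₃ U).trace := by rw [sum_mul]
    _ ≤ (∑ c ∈ C, |w c|) / ((univ.filter fun U' : OddSet n => U'.1.card = t).card : ℝ) * (X₃ U).trace :=
        mul_le_mul_of_nonneg_right (rowSum_absWeight_le t C w U) (hX₃ U).trace_nonneg

/-! ### §3 Blockwise pricing: SIGN ⊕ DOMINATION ⊕ JUNK -/

/-- **SIGN ⊕ DOMINATION (cut side).** For `n` even, an exact design `(n, t = 2c'+1, T, D, B_v, C, w)` with `D ≤ 2c'`, `5D ≤ 2c'+2`,
`2c'+5D ≤ n`, and a cut side `X = A Aᵀ + X₂` where `A_U` (`r × m`) has Johnson degree `≤ k` (`2k ≤ D`, `4k ≤ t`) and `X₂` is a psd-contraction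
family WELL-CONDITIONED AGAINST the contraction-valued matching side `Y` (`Σ_{|U|=t} X₂_U ⪰ μ·C(n,t)·I`, `Σ_M Y_M ⪰ ν·|PM|·I`, `μν ≥ 64/n`):
`Σ_{U,M} W·tr(X_U Y_M) ≤ r·(Σ_c|w_c|)·√(Π_{i≤D/2}(2i+1)/(n−2i))` — at EVERY dimension `r`. The Gram block is priced `≤ 0` by Grigoriev's
knapsack pseudo-expectation (brick 23), the second block by whitening (brick 87d). [cite: Grigoriev2001, Lemma 1.4 (PDF p. 8)]
[cite: Rothvoss2017, §2 (PDF p. 6)] [cite: GriblingDelaatLaurent2019, §5] -/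
theorem value_le_tail_of_lowDegree_add_wellConditioned {c' T D m k : ℕ} {Bv : ℝ} {C : Finset ℕ} {w : ℕ → ℝ} (hn : Even n)
    (hdes : IsExactDesign n (2 * c' + 1) T D Bv C w) (hD : D ≤ 2 * c') (hD1 : 5 * D ≤ 2 * c' + 2) (hD2 : 2 * c' + 5 * D ≤ n)
    (h2k : 2 * k ≤ D) (h4k : 4 * k ≤ 2 * c' + 1)
    (A : OddSet n → Matrix (Fin r) (Fin m) ℝ) (hA : IsLowDegreeU n k A)
    (X₂ : OddSet n → Matrix (Fin r) (Fin r) ℝ) (Y : PMatch n → Matrix (Fin r) (Fin r) ℝ)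
    (hX₂ : ∀ U, (X₂ U).PosSemidef ∧ (1 - X₂ U).PosSemidef) (hY : ∀ M, (Y M).PosSemidef ∧ (1 - Y M).PosSemidef)
    {μ ν : ℝ} (hμ : 0 < μ) (hν : 0 < ν) (hμν : 64 / (n : ℝ) ≤ μ * ν)
    (hXbar : ((∑ U : OddSet n, if U.1.card = 2 * c' + 1 then X₂ U else 0) -
      (μ * (n.choose (2 * c' + 1) : ℝ)) • (1 : Matrix (Fin r) (Fin r) ℝ)).PosSemidef)
    (hYbar : ((∑ M, Y M) - (ν * (Fintype.card (PMatch n) : ℝ)) • (1 : Matrix (Fin r) (Fin r) ℝ)).PosSemidef) :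
    ∑ U : OddSet n, ∑ M : PMatch n, levelWeight n (2 * c' + 1) C w U M * ((A U * (A U)ᵀ + X₂ U) * Y M).trace ≤
      (r : ℝ) * ((∑ c ∈ C, |w c|) * Real.sqrt (∏ i ∈ range (D / 2 + 1), ((2 * i + 1 : ℝ) / ((n : ℝ) - 2 * i)))) := by
  rw [value_add_left]
  have h1 := sum_levelWeight_trace_nonpos_of_lowDegree Grigoriev2001_knapsackFormNonneg_holds hdes h2k h4k A hA Y fun M => (hY M).1
  have h2 := value_le_tail_of_minDensity hn hdes hD hD1 hD2 X₂ Y hX₂ hY hμ hν hμν hXbar hYbar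
  linarith

/-- **SIGN ⊕ DOMINATION (matching side).** The mirror statement: `Y = B Bᵀ + Y₂` with `B_M` (`r × m`) of matching degree `≤ k` (`2k ≤ D`,
`6k+1 ≤ t`, `6k+1 ≤ n−t`; priced `≤ 0` against the psd contraction family `X` by the Grigoriev ⊗ Grigoriev pseudo-matching form, brick
`…PseudoMatchingBaseTransport`) and `(X, Y₂)` well-conditioned (`μν ≥ 64/n`): value `≤ r·(Σ_c|w_c|)·√P`. [cite: Grigoriev2001, Lemma 1.4 (PDF p. 8)]
[cite: Potechin2019, Thm. 1.2 (61:4)] [cite: Rothvoss2017, §2 (PDF p. 6)] -/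
theorem value_le_tail_of_wellConditioned_add_lowDegreeM {c' T D m k : ℕ} {Bv : ℝ} {C : Finset ℕ} {w : ℕ → ℝ} (hn : Even n)
    (hdes : IsExactDesign n (2 * c' + 1) T D Bv C w) (hD : D ≤ 2 * c') (hD1 : 5 * D ≤ 2 * c' + 2) (hD2 : 2 * c' + 5 * D ≤ n)
    (h2k : 2 * k ≤ D) (hkt : 6 * k + 1 ≤ 2 * c' + 1) (hknt : 6 * k + 1 ≤ n - (2 * c' + 1))
    (X : OddSet n → Matrix (Fin r) (Fin r) ℝ) (hX : ∀ U, (X U).PosSemidef ∧ (1 - X U).PosSemidef)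
    (B : PMatch n → Matrix (Fin r) (Fin m) ℝ) (hB : IsLowDegreeM n k B)
    (Y₂ : PMatch n → Matrix (Fin r) (Fin r) ℝ) (hY₂ : ∀ M, (Y₂ M).PosSemidef ∧ (1 - Y₂ M).PosSemidef)
    {μ ν : ℝ} (hμ : 0 < μ) (hν : 0 < ν) (hμν : 64 / (n : ℝ) ≤ μ * ν)
    (hXbar : ((∑ U : OddSet n, if U.1.card = 2 * c' + 1 then X U else 0) -
      (μ * (n.choose (2 * c' + 1) : ℝ)) • (1 : Matrix (Fin r) (Fin r) ℝ)).PosSemidef)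
    (hYbar : ((∑ M, Y₂ M) - (ν * (Fintype.card (PMatch n) : ℝ)) • (1 : Matrix (Fin r) (Fin r) ℝ)).PosSemidef) :
    ∑ U : OddSet n, ∑ M : PMatch n, levelWeight n (2 * c' + 1) C w U M * (X U * (B M * (B M)ᵀ + Y₂ M)).trace ≤
      (r : ℝ) * ((∑ c ∈ C, |w c|) * Real.sqrt (∏ i ∈ range (D / 2 + 1), ((2 * i + 1 : ℝ) / ((n : ℝ) - 2 * i)))) := by
  rw [value_add_right]
  have h1 := sum_levelWeight_trace_nonpos_of_lowDegreeM hn hdes h2k hkt hknt X (fun U => (hX U).1) B hB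
  have h2 := value_le_tail_of_minDensity hn hdes hD hD1 hD2 X Y₂ hX hY₂ hμ hν hμν hXbar hYbar
  linarith

/-- **FOUR BLOCKS (both sides split).** `X = A Aᵀ + X₂`, `Y = B Bᵀ + Y₂` with `A` of Johnson degree `≤ k`, `B` of matching degree `≤ k'`
(`2k, 2k' ≤ D`, `4k ≤ t`, `6k'+1 ≤ t`, `6k'+1 ≤ n−t`), `X₂`, `Y₂` psd-contraction families with `(X₂, Y₂)` well-conditioned (`μν ≥ 64/n`): the four
cross values are `value(AAᵀ, BBᵀ) ≤ 0`, `value(AAᵀ, Y₂) ≤ 0` (cut-side SIGN against a psd matching side), `value(X₂, BBᵀ) ≤ 0` (matching-side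
SIGN) and `value(X₂, Y₂) ≤ tail·r` (DOMINATION), so `value(X, Y) ≤ r·(Σ_c|w_c|)·√P`. [cite: Grigoriev2001, Lemma 1.4 (PDF p. 8)]
[cite: Potechin2019, Thm. 1.2 (61:4)] [cite: Rothvoss2017, §2 (PDF p. 6)] [cite: GriblingDelaatLaurent2019, §5] -/
theorem value_le_tail_of_fourBlocks {c' T D m m' k k' : ℕ} {Bv : ℝ} {C : Finset ℕ} {w : ℕ → ℝ} (hn : Even n)
    (hdes : IsExactDesign n (2 * c' + 1) T D Bv C w) (hD : D ≤ 2 * c') (hD1 : 5 * D ≤ 2 * c' + 2) (hD2 : 2 * c' + 5 * D ≤ n)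
    (h2k : 2 * k ≤ D) (h4k : 4 * k ≤ 2 * c' + 1)
    (h2k' : 2 * k' ≤ D) (hkt : 6 * k' + 1 ≤ 2 * c' + 1) (hknt : 6 * k' + 1 ≤ n - (2 * c' + 1))
    (A : OddSet n → Matrix (Fin r) (Fin m) ℝ) (hA : IsLowDegreeU n k A)
    (B : PMatch n → Matrix (Fin r) (Fin m') ℝ) (hB : IsLowDegreeM n k' B)
    (X₂ : OddSet n → Matrix (Fin r) (Fin r) ℝ) (Y₂ : PMatch n → Matrix (Fin r) (Fin r) ℝ)
    (hX₂ : ∀ U, (X₂ U).PosSemidef ∧ (1 - X₂ U).PosSemidef) (hY₂ : ∀ M, (Y₂ M).PosSemidef ∧ (1 - Y₂ M).PosSemidef)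
    {μ ν : ℝ} (hμ : 0 < μ) (hν : 0 < ν) (hμν : 64 / (n : ℝ) ≤ μ * ν)
    (hXbar : ((∑ U : OddSet n, if U.1.card = 2 * c' + 1 then X₂ U else 0) -
      (μ * (n.choose (2 * c' + 1) : ℝ)) • (1 : Matrix (Fin r) (Fin r) ℝ)).PosSemidef)
    (hYbar : ((∑ M, Y₂ M) - (ν * (Fintype.card (PMatch n) : ℝ)) • (1 : Matrix (Fin r) (Fin r) ℝ)).PosSemidef) :
    ∑ U : OddSet n, ∑ M : PMatch n,
        levelWeight n (2 * c' + 1) C w U M * ((A U * (A U)ᵀ + X₂ U) * (B M * (B M)ᵀ + Y₂ M)).trace ≤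
      (r : ℝ) * ((∑ c ∈ C, |w c|) * Real.sqrt (∏ i ∈ range (D / 2 + 1), ((2 * i + 1 : ℝ) / ((n : ℝ) - 2 * i)))) := by
  rw [value_add_left, value_add_right, value_add_right]
  -- SIGN (cut side) against the psd matching sides `B Bᵀ` and `Y₂`
  have h11 := sum_levelWeight_trace_nonpos_of_lowDegree Grigoriev2001_knapsackFormNonneg_holds hdes h2k h4k A hA
    (fun M => B M * (B M)ᵀ) fun M => posSemidef_mul_transpose_self (B M)
  have h12 := sum_levelWeight_trace_nonpos_of_lowDegree Grigoriev2001_knapsackFormNonneg_holds hdes h2k h4k A hA Y₂ fun M => (hY₂ M).1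
  -- SIGN (matching side) against the psd cut side `X₂`
  have h21 := sum_levelWeight_trace_nonpos_of_lowDegreeM hn hdes h2k' hkt hknt X₂ (fun U => (hX₂ U).1) B hB
  -- DOMINATION
  have h22 := value_le_tail_of_minDensity hn hdes hD hD1 hD2 X₂ Y₂ hX₂ hY₂ hμ hν hμν hXbar hYbar
  linarith

/-- **THREE BLOCKS ON THE CUT SIDE: SIGN ⊕ DOMINATION ⊕ JUNK.** `X = A Aᵀ + X₂ + X₃` with `A` of Johnson degree `≤ k` (`2k ≤ D`, `4k ≤ t`),
`(X₂, Y)` a well-conditioned pair of psd-contraction families (`μν ≥ 64/n`) and `X₃` ANY psd family of slice trace mass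
`Σ_U tr X₃_U ≤ mass·#{t-cuts}` (`mass ≥ 0`): `value(X, Y) ≤ r·(Σ_c|w_c|)·√P + (Σ_c|w_c|)·mass`. This is the price list of MEMO-19 §2(h)'s psd-preserving
decomposition, by name; what is OPEN is whether every contraction field so decomposes (blocks may depend on `Y`) with `mass ≤ e^{−aD}·r/40`.
[cite: Grigoriev2001, Lemma 1.4 (PDF p. 8)] [cite: Rothvoss2017, §2 (PDF p. 6)] [cite: GriblingDelaatLaurent2019, §5]
[cite: BrietDadushPokutta2014, Thm. 6 (§3)] -/
theorem value_le_of_threeBlocks {c' T D m k : ℕ} {Bv mass : ℝ} {C : Finset ℕ} {w : ℕ → ℝ} (hn : Even n)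
    (hdes : IsExactDesign n (2 * c' + 1) T D Bv C w) (hD : D ≤ 2 * c') (hD1 : 5 * D ≤ 2 * c' + 2) (hD2 : 2 * c' + 5 * D ≤ n)
    (h2k : 2 * k ≤ D) (h4k : 4 * k ≤ 2 * c' + 1)
    (A : OddSet n → Matrix (Fin r) (Fin m) ℝ) (hA : IsLowDegreeU n k A)
    (X₂ X₃ : OddSet n → Matrix (Fin r) (Fin r) ℝ) (Y : PMatch n → Matrix (Fin r) (Fin r) ℝ)
    (hX₂ : ∀ U, (X₂ U).PosSemidef ∧ (1 - X₂ U).PosSemidef) (hX₃ : ∀ U, (X₃ U).PosSemidef)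
    (hY : ∀ M, (Y M).PosSemidef ∧ (1 - Y M).PosSemidef)
    {μ ν : ℝ} (hμ : 0 < μ) (hν : 0 < ν) (hμν : 64 / (n : ℝ) ≤ μ * ν)
    (hXbar : ((∑ U : OddSet n, if U.1.card = 2 * c' + 1 then X₂ U else 0) -
      (μ * (n.choose (2 * c' + 1) : ℝ)) • (1 : Matrix (Fin r) (Fin r) ℝ)).PosSemidef)
    (hYbar : ((∑ M, Y M) - (ν * (Fintype.card (PMatch n) : ℝ)) • (1 : Matrix (Fin r) (Fin r) ℝ)).PosSemidef)
    (hmass0 : 0 ≤ mass)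
    (hmass : ∑ U, (X₃ U).trace ≤ mass * ((univ.filter fun U' : OddSet n => U'.1.card = 2 * c' + 1).card : ℝ)) :
    ∑ U : OddSet n, ∑ M : PMatch n, levelWeight n (2 * c' + 1) C w U M * ((A U * (A U)ᵀ + X₂ U + X₃ U) * Y M).trace ≤
      (r : ℝ) * ((∑ c ∈ C, |w c|) * Real.sqrt (∏ i ∈ range (D / 2 + 1), ((2 * i + 1 : ℝ) / ((n : ℝ) - 2 * i)))) +
        (∑ c ∈ C, |w c|) * mass := by
  rw [value_add_left]
  have h12 := value_le_tail_of_lowDegree_add_wellConditioned hn hdes hD hD1 hD2 h2k h4k A hA X₂ Y hX₂ hY hμ hν hμν hXbar hYbar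
  have h3 := value_le_absVar_mul_traceMass (2 * c' + 1) C w X₃ hX₃ Y hY
  -- the junk bound `(Σ|w|)/#cuts · Σ tr X₃ ≤ (Σ|w|)·mass`
  set N : ℝ := ((univ.filter fun U' : OddSet n => U'.1.card = 2 * c' + 1).card : ℝ) with hN
  have hw : 0 ≤ ∑ c ∈ C, |w c| := sum_nonneg fun c _ => abs_nonneg _
  have h3' : (∑ c ∈ C, |w c|) / N * ∑ U, (X₃ U).trace ≤ (∑ c ∈ C, |w c|) * mass := by
    rcases eq_or_lt_of_le (show (0 : ℝ) ≤ N by positivity) with hN0 | hNpos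
    · rw [← hN0, div_zero, zero_mul]
      exact mul_nonneg hw hmass0
    · rw [div_mul_eq_mul_div, div_le_iff₀ hNpos]
      calc (∑ c ∈ C, |w c|) * ∑ U, (X₃ U).trace ≤ (∑ c ∈ C, |w c|) * (mass * N) := mul_le_mul_of_nonneg_left hmass hw
        _ = (∑ c ∈ C, |w c|) * mass * N := by ring
  linarith

/-! ### §4 JUNK on the matching side (appended, prover g17): a trace-small psd matching block is priced by its column trace mass -/

/-- **Column sums of `|levelWeight|`.** For every perfect matching `M`: `Σ_U absWeight(U,M) ≤ (Σ_{c∈C} |w_c|) / |PM|` — each level class `Q_c(t)` has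
`#{U : |U| = t, cc(U,M) = c}·|PM|` elements for every `M` (`…LevelMarginals.card_Qset_eq_colCount_mul`). [cite: Rothvoss2017, §2 (PDF p. 6)] -/
theorem colSum_absWeight_le (t : ℕ) (C : Finset ℕ) (w : ℕ → ℝ) (M : PMatch n) :
    ∑ U, absWeight n t C w U M ≤ (∑ c ∈ C, |w c|) / (Fintype.card (PMatch n) : ℝ) := by
  classical
  unfold absWeight
  rw [sum_comm, sum_div]
  refine sum_le_sum fun c _ => ?_
  have hmem : ∀ U : OddSet n, ((U, M) ∈ Qset n t c ↔ (U.1.card = t ∧ cc U M = c)) := fun U => by rw [mem_Qset_iff]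
  have hfilt : (univ.filter fun U : OddSet n => (U, M) ∈ Qset n t c) = univ.filter fun U : OddSet n => U.1.card = t ∧ cc U M = c :=
    filter_congr fun U _ => hmem U
  have h1 : ∑ U : OddSet n, (if (U, M) ∈ Qset n t c then |w c| / ((Qset n t c).card : ℝ) else 0) =
      ((univ.filter fun U : OddSet n => U.1.card = t ∧ cc U M = c).card : ℝ) * (|w c| / ((Qset n t c).card : ℝ)) := by
    rw [← sum_filter, sum_const, nsmul_eq_mul, hfilt]
  rw [h1, card_Qset_eq_colCount_mul t c M]
  set R : ℝ := ((univ.filter fun U : OddSet n => U.1.card = t ∧ cc U M = c).card : ℝ) with hR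
  set N : ℝ := (Fintype.card (PMatch n) : ℝ) with hN
  have hN0 : 0 < N := by rw [hN]; exact_mod_cast Fintype.card_pos_iff.2 ⟨M⟩
  rcases eq_or_lt_of_le (show (0 : ℝ) ≤ R by positivity) with hR0 | hRpos
  · rw [← hR0]; simp only [zero_mul]; positivity
  · rw [mul_div_assoc', div_le_div_iff₀ (by positivity) hN0]
    nlinarith [abs_nonneg (w c)]

/-- **JUNK BLOCK ON THE MATCHING SIDE.** For a multilevel weight `W = levelWeight n t C w`, any contraction-valued cut side `X` and ANY psd matching
family `Y₃` (no contraction bound needed): `Σ_{U,M} W(U,M)·tr(X_U Y₃_M) ≤ (Σ_c |w_c|)·(Σ_M tr Y₃_M)/|PM|` — a matching block of column trace mass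
`Σ_M tr Y₃_M ≤ m·|PM|` costs at most `(Σ_c|w_c|)·m`. With brick 86's one-sided form (`Y_M = P_M` the positive spectral projection of the virtual average)
this says: matchings whose test projection has rank `≤ ρ` contribute at most `(Σ_c|w_c|)·ρ·(their fraction)` — WLOG the negative eigenspaces of
`Ẽ_M[X]` are `e^{−aD}r/40`-dimensional on the matchings that matter. [cite: Rothvoss2017, §2 (PDF p. 6)] [cite: BrietDadushPokutta2014, Thm. 6 (§3)] -/
theorem value_le_absVar_mul_traceMass_right (t : ℕ) (C : Finset ℕ) (w : ℕ → ℝ)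
    (X : OddSet n → Matrix (Fin r) (Fin r) ℝ) (hX : ∀ U, (X U).PosSemidef ∧ (1 - X U).PosSemidef)
    (Y₃ : PMatch n → Matrix (Fin r) (Fin r) ℝ) (hY₃ : ∀ M, (Y₃ M).PosSemidef) :
    ∑ U, ∑ M, levelWeight n t C w U M * (X U * Y₃ M).trace ≤
      (∑ c ∈ C, |w c|) / (Fintype.card (PMatch n) : ℝ) * ∑ M, (Y₃ M).trace := by
  rw [sum_comm, mul_sum]
  refine sum_le_sum fun M _ => ?_
  have htr : ∀ U, 0 ≤ (X U * Y₃ M).trace ∧ (X U * Y₃ M).trace ≤ (Y₃ M).trace := fun U => by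
    constructor
    · exact trace_mul_nonneg_of_psd (hX U).1 (hY₃ M)
    · rw [Matrix.trace_mul_comm]
      exact trace_mul_le_trace_left (hY₃ M) (hX U).2
  calc ∑ U, levelWeight n t C w U M * (X U * Y₃ M).trace
      ≤ ∑ U, absWeight n t C w U M * (Y₃ M).trace := by
        refine sum_le_sum fun U _ => ?_
        obtain ⟨h0, h1⟩ := htr U
        calc levelWeight n t C w U M * (X U * Y₃ M).trace ≤ absWeight n t C w U M * (X U * Y₃ M).trace :=
              mul_le_mul_of_nonneg_right (levelWeight_le_absWeight t C w U M) h0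
          _ ≤ absWeight n t C w U M * (Y₃ M).trace := mul_le_mul_of_nonneg_left h1 (absWeight_nonneg t C w U M)
    _ = (∑ U, absWeight n t C w U M) * (Y₃ M).trace := by rw [sum_mul]
    _ ≤ (∑ c ∈ C, |w c|) / (Fintype.card (PMatch n) : ℝ) * (Y₃ M).trace :=
        mul_le_mul_of_nonneg_right (colSum_absWeight_le t C w M) (hY₃ M).trace_nonneg

/-! ### §5 STABILITY (appended, prover g17): the design value is `(Σ|w_c|)·η·r`-Lipschitz in the sup operator norm of either side -/

/-- **OPERATOR-NORM PERTURBATIONS OF THE CUT SIDE ARE CHEAP.** For a multilevel weight `W = levelWeight n t C w`, any cut field `E` with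
`−η·I ⪯ E_U ⪯ η·I` for all `U`, and any psd-contraction family `Y` on the perfect matchings:
`|Σ_{U,M} W(U,M)·tr(E_U Y_M)| ≤ (Σ_c |w_c|)·η·r` — via `|tr(E Y)| ≤ η·tr Y ≤ η·r` and the column sums of `|W|` (§4). Consequently the SIGN cells
(bricks 23/88b/89/90/90b) price every field that is `η`-CLOSE IN OPERATOR NORM to a low-degree Gram field, at the extra cost `(Σ|w_c|)·η·r`
(`value_le_of_opNorm_close`): 'approximate Johnson degree' of a Gram factor, not exact degree, is what the SIGN cell reads.
[cite: Rothvoss2017, §2 (PDF p. 6)] [cite: BrietDadushPokutta2014, Thm. 6 (§3)] -/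
theorem abs_value_le_of_opNorm (t : ℕ) (C : Finset ℕ) (w : ℕ → ℝ) {η : ℝ} (hη : 0 ≤ η)
    (E : OddSet n → Matrix (Fin r) (Fin r) ℝ)
    (hE : ∀ U, (η • (1 : Matrix (Fin r) (Fin r) ℝ) - E U).PosSemidef ∧ (η • (1 : Matrix (Fin r) (Fin r) ℝ) + E U).PosSemidef)
    (Y : PMatch n → Matrix (Fin r) (Fin r) ℝ) (hY : ∀ M, (Y M).PosSemidef ∧ (1 - Y M).PosSemidef) :
    |∑ U, ∑ M, levelWeight n t C w U M * (E U * Y M).trace| ≤ (∑ c ∈ C, |w c|) * η * r := by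
  have hEY : ∀ U M, |(E U * Y M).trace| ≤ η * r := fun U M => by
    rw [Matrix.trace_mul_comm]
    exact (abs_trace_mul_le (hY M).1 (hE U)).trans (mul_le_mul_of_nonneg_left (trace_le_of_sub_posSemidef (hY M).2) hη)
  have hPm : 0 ≤ (Fintype.card (PMatch n) : ℝ) := Nat.cast_nonneg _
  calc |∑ U, ∑ M, levelWeight n t C w U M * (E U * Y M).trace|
      ≤ ∑ U, |∑ M, levelWeight n t C w U M * (E U * Y M).trace| := abs_sum_le_sum_abs _ _
    _ ≤ ∑ U, ∑ M, |levelWeight n t C w U M * (E U * Y M).trace| := sum_le_sum fun U _ => abs_sum_le_sum_abs _ _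
    _ ≤ ∑ U, ∑ M, absWeight n t C w U M * (η * r) := by
        refine sum_le_sum fun U _ => sum_le_sum fun M _ => ?_
        rw [abs_mul]
        exact mul_le_mul (abs_levelWeight_le_absWeight t C w U M) (hEY U M) (abs_nonneg _) (absWeight_nonneg t C w U M)
    _ = (∑ M, ∑ U, absWeight n t C w U M) * (η * r) := by
        rw [sum_mul, sum_comm]; exact sum_congr rfl fun M _ => by rw [sum_mul]
    _ ≤ (∑ _M : PMatch n, (∑ c ∈ C, |w c|) / (Fintype.card (PMatch n) : ℝ)) * (η * r) :=
        mul_le_mul_of_nonneg_right (sum_le_sum fun M _ => colSum_absWeight_le t C w M) (by positivity)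
    _ ≤ (∑ c ∈ C, |w c|) * η * r := by
        rw [sum_const, card_univ, nsmul_eq_mul]
        rcases eq_or_lt_of_le hPm with h0 | hpos
        · rw [← h0]; simp only [zero_mul, div_zero]
          have : 0 ≤ ∑ c ∈ C, |w c| := sum_nonneg fun c _ => abs_nonneg _
          positivity
        · rw [mul_div_cancel₀ _ hpos.ne', mul_assoc]

/-- **APPROXIMATE SIGN (or any) CELL.** If `X = S + E` on the cuts with `−η·I ⪯ E_U ⪯ η·I` and the approximant `S` is priced at `β` against the
psd-contraction family `Y` (`Σ W·tr(S_U Y_M) ≤ β` — e.g. `S` a low-degree Gram field, bricks 23/89/90), then `Σ W·tr(X_U Y_M) ≤ β + (Σ_c|w_c|)·η·r`.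
[cite: Rothvoss2017, §2 (PDF p. 6)] -/
theorem value_le_of_opNorm_close (t : ℕ) (C : Finset ℕ) (w : ℕ → ℝ) {η β : ℝ} (hη : 0 ≤ η)
    (X S : OddSet n → Matrix (Fin r) (Fin r) ℝ)
    (hE : ∀ U, (η • (1 : Matrix (Fin r) (Fin r) ℝ) - (X U - S U)).PosSemidef ∧ (η • (1 : Matrix (Fin r) (Fin r) ℝ) + (X U - S U)).PosSemidef)
    (Y : PMatch n → Matrix (Fin r) (Fin r) ℝ) (hY : ∀ M, (Y M).PosSemidef ∧ (1 - Y M).PosSemidef)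
    (hS : ∑ U, ∑ M, levelWeight n t C w U M * (S U * Y M).trace ≤ β) :
    ∑ U, ∑ M, levelWeight n t C w U M * (X U * Y M).trace ≤ β + (∑ c ∈ C, |w c|) * η * r := by
  have hsplit : ∀ U, X U = S U + (X U - S U) := fun U => by abel
  have h := abs_value_le_of_opNorm t C w hη (fun U => X U - S U) hE Y hY
  have h' := (abs_le.1 h).2
  calc ∑ U, ∑ M, levelWeight n t C w U M * (X U * Y M).trace
      = ∑ U, ∑ M, levelWeight n t C w U M * ((S U + (X U - S U)) * Y M).trace :=
        sum_congr rfl fun U _ => sum_congr rfl fun M _ => by rw [← hsplit U]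
    _ = ∑ U, ∑ M, levelWeight n t C w U M * (S U * Y M).trace +
          ∑ U, ∑ M, levelWeight n t C w U M * ((X U - S U) * Y M).trace := value_add_left _ S (fun U => X U - S U) Y
    _ ≤ β + (∑ c ∈ C, |w c|) * η * r := add_le_add hS h'

end Summit.PneNP.PneNP.Theorems.ChebyshevTracialDesignBlockDecomposition

end
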